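import Summits.BirchSwinnertonDyer.BirchSwinnertonDyer.Theorems.EisensteinDepletionAtTwoStarOptBSFSigmaNodeFifteen
import Summits.BirchSwinnertonDyer.BirchSwinnertonDyer.Theorems.EisensteinDepletionAtTwoStarPrimeLevelSeventeenByName
import HarnessLib

/-!
# Line `star` on crux E1M (stmt-BirchSwinnertonDyer-20341): the `−256` branch — a Neumann–Setzer-shape MID point with a CENTRE partner is the `17a1`
# shape (`α = ±30`, `Δ = −17⁴`, level 17), so (T2′) — hence (T2) — follows from the node law (N256) and PRINTS alone

Lead star-p1 GEN 17.  After Theorems/…SigmaNodeFifteen the archimedean residue of E1M's squarefree case was (T2‴) «no `−256`-shape MID point on the lattice-optimal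
curve of a habitat class».  But the MID walk (Theorems/…MidWalk) only needs the MID point's partner NOT to be a centre, and in the `−256` branch the centre
condition `β/2 ∈ ℚ²` is again a finite Diophantine equation: `α = b₂ + 12m = 2a` with `a` odd (`8β` odd), `β/2 = (α² + 256)/64 = (a² + 64)/16`, and
`a² + 64 = c²` forces `a = ±15` (`int_eq_of_sq_add_sixtyfour`), i.e. `α = ±30`, `β = 289/8`, `Δ(W₀) = −64β² = −83521 = −17⁴` — the shape of `17a1 = X₀(17)`
(`α = 30` at `r = 11/4`).  Then every prime of the (squarefree) level divides the minimal discriminant, so `N ∣ 17`, `N ≠ 1` (Tate–Ogg), `N = 17`: but at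
conductor 17 no curve carries a unique rational 2-torsion point of type A xor B (Cremona's table, tree named fact
`Cremona1997_conductor_seventeen_classification`, via `not_prop514_of_conductor_seventeen_of_cremona`) — contradiction with the habitat hypothesis.
Together with the `+256` branch (…SigmaNodeFifteen: `α = −34`, level `∣ 15`, Setzer) this gives
  **(T2′) ⇐ (N256) + PRINTS {UBD, Edixhoven, Setzer, Cremona-17}** (`partnerNotCentre_of_sigmaNode_of_prints`),
so the research stub (T2)/(T2‴) DISAPPEARS: the squarefree residue of E1M is the node law (N256) alone, plus prints.
(Consistency: for the Neumann–Setzer curves `E₀(u)` one has `α = 2u`, and `u = ±15` would give `N = 289`, not prime — their partner `E₁(u)` is never a centre;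
`17a1` (`α = 30`) has the centre partner `17a2`, and 17a is not a habitat class.)

* `int_eq_of_sq_add_sixtyfour` — `a` odd, `a² + 64 = c²` ⇒ `a = ±15`;
* `alpha_eq_of_complDisc_eq_neg_of_isSquare` — `−256` and `β/2 ∈ ℚ²` ⇒ `α = 30 ∨ α = −30`;
* `false_of_seventeenShape` — habitat binders + `−256` + `α = ±30` ⇒ `False` (mod Cremona-17);
* `partnerNotCentre_of_sigmaNode_of_prints` — (T2′) VERBATIM ⇐ UBD + Edixhoven + Setzer + Cremona-17 + (N256).

CONDITIONAL on the four prints and on (N256); no `sorry`, no new definition; nothing here reads `r_an`; StarOptB / E1M / BSD NOT proved.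
-/

set_option linter.dupNamespace false
set_option autoImplicit false

noncomputable section

open scoped Classical MatrixGroups
open CongruenceSubgroup
open WeierstrassCurve Literature.NumberTheory.EllipticCurves Literature.NumberTheory.EllipticCurves.Greenberg1999
open Literature.NumberTheory.EllipticCurves.ModularForms

namespace Summit.BirchSwinnertonDyer.BirchSwinnertonDyer.Theorems.DepletionAtTwo.SigmaNode

/-! ### The Diophantine lemma of the `−256` branch -/

/-- **`a` odd and `a² + 64 = c²` ⇒ `a = ±15`** (`c` odd; `(c − a)/2 · (c + a)/2 = 16`). [folklore] -/
theorem int_eq_of_sq_add_sixtyfour {a c : ℤ} (ha : Odd a) (h : a ^ 2 + 64 = c ^ 2) : a = 15 ∨ a = -15 := by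
  have hc : Odd c := by
    have : Odd (c ^ 2) := by
      rw [← h]
      exact ha.pow.add_even ⟨32, by norm_num⟩
    exact (Int.odd_pow' two_ne_zero).mp this
  obtain ⟨k, hk⟩ := ha
  obtain ⟨l, hl⟩ := hc
  -- `a = 2k+1`, `c = 2l+1`: `(l − k)(l + k + 1) = 16`
  have hprod : (l - k) * (l + k + 1) = 16 := by
    have : (2 * k + 1) ^ 2 + 64 = (2 * l + 1) ^ 2 := by rw [← hk, ← hl]; exact h
    linarith [this]
  have hdvd : (l - k) ∣ 16 := ⟨l + k + 1, hprod.symm⟩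
  have hbound := Int.le_of_dvd (by norm_num) hdvd
  have hbound' : -16 ≤ l - k := by
    have h1 : -(l - k) ∣ 16 := (neg_dvd).mpr hdvd
    have := Int.le_of_dvd (by norm_num) h1
    linarith
  set d := l - k with hd
  have hkl : l + k + 1 = 2 * k + 1 + d := by rw [hd]; ring
  rw [hkl] at hprod
  rw [hk]
  interval_cases d <;> omega

/-- **In the `−256` branch, `β/2 ∈ ℚ²` forces `α = ±30`.**  With `b₂ = B₂`, `b₄ = B₄`, `4m = ξ` odd: `8β` is odd, `α² = 32β − 256` gives `α = 2a`, `a` odd,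
`a² + 64 = 16·(β/2)`; if `β/2 = w²` then `a² + 64 = (4w)²` is an integer square, so `a = ±15`. [cite: SilvermanAEC2009, III.1 (b-invariants)] -/
theorem alpha_eq_of_complDisc_eq_neg_of_isSquare (W₀ : WeierstrassCurve ℚ) [W₀.IsGloballyMinimal] (hgood : W₀.HasGoodReductionAtPrime 2)
    {m : ℚ} (hm : HasRationalTwoTorsionX W₀ m) (hRm : TwoTorsionRamifiedAtTwo m)
    (hneg : (W₀.b₂ + 12 * m) ^ 2 - 32 * (W₀.b₄ + m * W₀.b₂ + 6 * m ^ 2) = -256)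
    (hsq : IsSquare ((W₀.b₄ + m * W₀.b₂ + 6 * m ^ 2) / 2)) :
    W₀.b₂ + 12 * m = 30 ∨ W₀.b₂ + 12 * m = -30 := by
  obtain ⟨B₂, B₄, ξ, hB₂, hB₄, hξ, hodd⟩ := exists_int_b₂_b₄_xi W₀ hgood hm hRm
  obtain ⟨w, hw⟩ := hsq
  have hm4 : m = (ξ : ℚ) / 4 := by rw [hξ]; ring
  set A : ℤ := B₂ + 3 * ξ with hA
  set E8 : ℤ := 8 * B₄ + 2 * ξ * B₂ + 3 * ξ ^ 2 with hE8
  have hαA : W₀.b₂ + 12 * m = (A : ℚ) := by rw [hA, hB₂, hm4]; push_cast; ring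
  have hβE : W₀.b₄ + m * W₀.b₂ + 6 * m ^ 2 = (E8 : ℚ) / 8 := by rw [hE8, hB₂, hB₄, hm4]; push_cast; ring
  have hE8odd : Odd E8 := by
    rw [hE8]
    have h3 : Odd (3 * ξ ^ 2) := Odd.mul (by decide) hodd.pow
    have h2 : Even (8 * B₄ + 2 * ξ * B₂) := ⟨4 * B₄ + ξ * B₂, by ring⟩
    exact h2.add_odd h3
  have hAE : (A : ℚ) ^ 2 = 4 * E8 - 256 := by
    have := hneg; rw [hαA, hβE] at this; linarith
  have hAEℤ : A ^ 2 = 4 * E8 - 256 := by exact_mod_cast hAE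
  have hAeven : Even A := by
    have : Even (A ^ 2) := by rw [hAEℤ]; exact ⟨2 * E8 - 128, by ring⟩
    exact (Int.even_pow' two_ne_zero).mp this
  obtain ⟨a, ha⟩ := hAeven
  have ha2 : A = 2 * a := by rw [ha]; ring
  have haE : a ^ 2 + 64 = E8 := by
    have := hAEℤ; rw [ha2] at this; linarith
  have haodd : Odd a := by
    have : Odd (a ^ 2) := by
      have he : a ^ 2 = E8 - 64 := by linarith
      rw [he]; exact hE8odd.sub_even ⟨32, by norm_num⟩
    exact (Int.odd_pow' two_ne_zero).mp this
  have hwE : (E8 : ℚ) / 16 = w * w := by rw [← hw, hβE]; ring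
  have hsqQ : IsSquare (((a ^ 2 + 64 : ℤ)) : ℚ) := by
    refine ⟨4 * w, ?_⟩
    have : ((a ^ 2 + 64 : ℤ) : ℚ) = (E8 : ℚ) := by rw [haE]
    rw [this]
    linear_combination 16 * hwE
  obtain ⟨c, hc⟩ := Rat.isSquare_intCast_iff.mp hsqQ
  have hc' : a ^ 2 + 64 = c ^ 2 := by rw [hc]; ring
  rcases int_eq_of_sq_add_sixtyfour haodd hc' with h | h
  · left; rw [hαA, ha2, h]; norm_num
  · right; rw [hαA, ha2, h]; norm_num

/-! ### The `17a1` shape has level 17, where there is no habitat -/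

/-- A prime dividing `83521 = 17⁴` is `17`. [folklore] -/
theorem eq_seventeen_of_prime_dvd {p : ℕ} (hp : p.Prime) (h : p ∣ 83521) : p = 17 := by
  have h' : p ∣ 17 ^ 4 := by norm_num at h ⊢; exact h
  exact (Nat.prime_dvd_prime_iff_eq hp (by norm_num)).mp (hp.dvd_of_dvd_pow h')

/-- **`−256` and `α = ±30` on the lattice-optimal curve of a habitat class at squarefree level is impossible** (mod Cremona's conductor-17 table).
`β = 289/8`, `Δ(W₀) = −64β² = −83521 = −17⁴`; primes of the level `N = N_W` are bad for `W₀`, so equal `17`; `N` squarefree ⇒ `N ∣ 17`; `N ≠ 1` (Tate–Ogg for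
`W`); `N = 17` contradicts the habitat hypothesis (`not_prop514_of_conductor_seventeen_of_cremona`). CONDITIONAL on `Cremona1997_conductor_seventeen_classification`.
[cite: CremonaAlgorithms1997, Table 1 (N = 17)] [cite: AtkinLehner1970, Thm. 3] [cite: SilvermanAEC2009, VII.5 Prop. 5.1 (a)] -/
theorem false_of_seventeenShape (hC : Cremona1997_conductor_seventeen_classification)
    (W : WeierstrassCurve ℚ) [W.IsElliptic] [W.IsGloballyMinimal] {x : ℚ} (hux : HasUniqueRationalTwoTorsionX W x)
    (htype : (TwoTorsionRamifiedAtTwo x ∧ ¬ TwoTorsionOdd W x) ∨ (TwoTorsionOdd W x ∧ ¬ TwoTorsionRamifiedAtTwo x))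
    (hsf : Squarefree (W.conductorNorm ℤ))
    {N : ℕ} [NeZero N] (f : CuspForm (Gamma0 N) 2) (hW : IsNewformOf W f)
    (W₀ : WeierstrassCurve ℚ) [W₀.IsElliptic] [W₀.IsGloballyMinimal] (hW₀ : IsNewformOf W₀ f)
    {x₀ : ℚ} (hx₀ : HasRationalTwoTorsionX W₀ x₀)
    (hneg : (W₀.b₂ + 12 * x₀) ^ 2 - 32 * (W₀.b₄ + x₀ * W₀.b₂ + 6 * x₀ ^ 2) = -256)
    (hα : W₀.b₂ + 12 * x₀ = 30 ∨ W₀.b₂ + 12 * x₀ = -30) : False := by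
  -- `Δ(W₀) = −83521`
  have h4 := four_mul_Δ_eq W₀ hx₀
  have hsq : (W₀.b₂ + 12 * x₀) ^ 2 = 900 := by rcases hα with h | h <;> rw [h] <;> norm_num
  have hβ : W₀.b₄ + x₀ * W₀.b₂ + 6 * x₀ ^ 2 = 289 / 8 := by linarith
  have hΔ : W₀.Δ = -83521 := by
    rw [hneg, hβ] at h4; linarith
  have hΔint : minimalDiscriminantInt W₀ = -83521 := by
    have h := cast_minimalDiscriminantInt W₀
    rw [hΔ] at h
    exact_mod_cast h
  have hNW : N = W.conductorNorm ℤ := hW.level_eq_conductorNorm_of_squarefree hsf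
  have hsqN : Squarefree N := by rw [hNW]; exact hsf
  have hprimes : ∀ p : ℕ, p.Prime → p ∣ N → p = 17 := by
    intro p hp hpN
    haveI : Fact p.Prime := ⟨hp⟩
    have hpW₀ : p ∣ W₀.conductorNorm ℤ := (hW₀.dvd_level_iff_dvd_conductorNorm hp).mp hpN
    have hbad : ¬ W₀.HasGoodReductionAtPrime p := (W₀.dvd_conductorNorm_iff_not_hasGoodReductionAtPrime p).mp hpW₀
    have hdvd : (p : ℤ) ∣ minimalDiscriminantInt W₀ := by
      by_contra h
      exact hbad (hasGoodReductionAtPrime_of_not_dvd W₀ p h)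
    rw [hΔint] at hdvd
    have hdvd' : (p : ℤ) ∣ 83521 := (dvd_neg).mp hdvd
    exact eq_seventeen_of_prime_dvd hp (by exact_mod_cast hdvd')
  -- `N ∣ 17`
  have hN17 : N ∣ 17 := by
    have hsub : N.primeFactors ⊆ ({17} : Finset ℕ) := by
      intro p hp
      rw [Finset.mem_singleton]
      exact hprimes p (Nat.prime_of_mem_primeFactors hp) (Nat.dvd_of_mem_primeFactors hp)
    have h17 : ∏ p ∈ ({17} : Finset ℕ), p = 17 := by decide
    rw [← Nat.prod_primeFactors_of_squarefree hsqN, ← h17]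
    exact Finset.prod_dvd_prod_of_subset _ _ _ hsub
  rcases (Nat.dvd_prime (by norm_num : Nat.Prime 17)).mp hN17 with h1 | h17
  · -- `N = 1`
    obtain ⟨p, hp, hbad⟩ := W.exists_prime_not_hasGoodReductionAtPrime
    have hpN : p ∣ W.conductorNorm ℤ := (W.dvd_conductorNorm_iff_not_hasGoodReductionAtPrime p).mpr hbad
    rw [← hNW, h1] at hpN
    exact hp.out.ne_one (Nat.dvd_one.mp hpN)
  · -- `N = 17`: no habitat at conductor 17
    have hN : W.conductorNorm ℤ = 17 := by rw [← hNW, h17]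
    exact not_prop514_of_conductor_seventeen_of_cremona hC W hN hux htype

/-! ### (T2′) from (N256) and prints alone -/

/-- **(T2′) «the MID point's 2-isogenous partner is not a centre» — the hypothesis of the MID walk's (T2) door — from the node law (N256) and FOUR PRINTS**
(UBD, Edixhoven: THEOREM A supplies the Σ-type hypothesis of (N256); Setzer: the `15a1` shape of the `+256` branch, `false_of_fifteenShape`; Cremona-17: the `17a1`
shape of the `−256` branch, `false_of_seventeenShape`).  With `MidWalk.optimalNotMidPointed_of_partnerNotCentre` this makes (T2) a consequence of (N256) + prints:
the research content of E1M at squarefree level is the node law alone.  CONDITIONAL on the prints and (N256).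
[cite: Setzer1975, pp. 367–378] [cite: CremonaAlgorithms1997, Table 1 (N = 17)] [cite: CalegariDimitrovTang2025, Thm. 1.0.1] [cite: Edixhoven1991, Prop. 2] -/
theorem partnerNotCentre_of_sigmaNode_of_prints
    (hU : Literature.NumberTheory.Automorphic.CalegariDimitrovTang2025_unboundedDenominators)
    (hEd : edixhoven_optimalManinConstant_integral) (hS : Setzer1975_primeConductor_rationalTwoTorsion)
    (hC : Cremona1997_conductor_seventeen_classification)
    (hN : ∀ (W₀ : WeierstrassCurve ℚ) [W₀.IsElliptic] [W₀.IsGloballyMinimal]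
      ⦃N : ℕ⦄ [NeZero N] (f : CuspForm (Gamma0 N) 2), IsNewformOf W₀ f → IsOrdinaryAt W₀ 2 →
      ∀ (L₀ : PeriodPair), IsNeronLatticeOf (W₀.baseChange ℂ) L₀ → ∀ (q : ℚ), q ≠ 0 →
      (∀ z ∈ periodLattice f, (q : ℂ) * z ∈ L₀.lattice) → (∀ z ∈ L₀.lattice, ∃ w ∈ periodLattice f, z = (q : ℂ) * w) →
      ∀ (x : ℚ), HasRationalTwoTorsionX W₀ x → TwoTorsionRamifiedAtTwo x →
      ∀ (lam : ℂ), lam ∈ L₀.lattice → lam / 2 ∉ L₀.lattice →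
        L₀.weierstrassP (lam / 2) - ((W₀.b₂ : ℚ) : ℂ) / 12 = ((x : ℚ) : ℂ) →
      (∀ (γ : SL(2, ℤ)) (hγ : γ ∈ Gamma0 N), γ ∈ Gamma1 N →
        ∃ k : ℤ, ∃ w ∈ L₀.lattice, (q : ℂ) * cuspSymbol f ⟨γ, hγ⟩ = (k : ℂ) * lam + 2 * w) →
      (W₀.b₂ + 12 * x) ^ 2 - 32 * (W₀.b₄ + x * W₀.b₂ + 6 * x ^ 2) = 256 ∨
        (W₀.b₂ + 12 * x) ^ 2 - 32 * (W₀.b₄ + x * W₀.b₂ + 6 * x ^ 2) = -256) :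
    ∀ (W : WeierstrassCurve ℚ) [W.IsElliptic] [W.IsGloballyMinimal] (x : ℚ), IsOrdinaryAt W 2 →
      HasUniqueRationalTwoTorsionX W x →
      ((TwoTorsionRamifiedAtTwo x ∧ ¬ TwoTorsionOdd W x) ∨ (TwoTorsionOdd W x ∧ ¬ TwoTorsionRamifiedAtTwo x)) →
      W.conductorNorm ℤ ≠ 15 → Squarefree (W.conductorNorm ℤ) →
      ∀ ⦃N : ℕ⦄ [NeZero N] (f : CuspForm (Gamma0 N) 2), IsNewformOf W f →
      ∀ (W₀ : WeierstrassCurve ℚ) [W₀.IsElliptic] [W₀.IsGloballyMinimal], IsNewformOf W₀ f →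
      ∀ (L₀ : PeriodPair), IsNeronLatticeOf (W₀.baseChange ℂ) L₀ → ∀ (q : ℚ), q ≠ 0 →
      (∀ z ∈ periodLattice f, (q : ℂ) * z ∈ L₀.lattice) → (∀ z ∈ L₀.lattice, ∃ w ∈ periodLattice f, z = (q : ℂ) * w) →
      ∀ (x₀ : ℚ), HasRationalTwoTorsionX W₀ x₀ → TwoTorsionRamifiedAtTwo x₀ → TwoTorsionOdd W₀ x₀ →
      ¬ IsSquare ((W₀.b₄ + x₀ * W₀.b₂ + 6 * x₀ ^ 2) / 2) := by
  intro W _ _ x hord hux htype h15 hsf N _ f hW W₀ _ _ hW₀ L₀ hL₀ q hq hin hout x₀ hx₀ hR₀ hO₀ hsq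
  have hiso : WeierstrassCurve.IsIsogenous W W₀ :=
    IsNewformOf.isIsogenous WeierstrassCurve.isIsogenous_iff_frobeniusTrace_eq_holds hW hW₀
  have hord₀ : IsOrdinaryAt W₀ 2 := Summit.BirchSwinnertonDyer.BirchSwinnertonDyer.Theorems.IsogenyMuShift.isOrdinaryAt_of_isIsogenous hiso hord
  obtain ⟨lam, hlam, hlam2, hwp⟩ := exists_half_period_of_hasRationalTwoTorsionX W₀ L₀ hL₀ hx₀
  have hpar := ThmAFormal.kummerParity_formal_of_mem_gamma1 hU hEd W₀ f hW₀ L₀ hL₀ q hq hin hout x₀ hx₀ hR₀ lam hlam hlam2 hwp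
  rcases hN W₀ f hW₀ hord₀ L₀ hL₀ q hq hin hout x₀ hx₀ hR₀ lam hlam hlam2 hwp hpar with h256 | hneg
  · have hα := alpha_eq_neg_of_mid_of_isSquare W₀ hord₀.1 hx₀ hR₀ hO₀ h256 hsq
    exact false_of_fifteenShape hS W hux.1 h15 hsf f hW W₀ hW₀ hx₀ h256 hα
  · have hα := alpha_eq_of_complDisc_eq_neg_of_isSquare W₀ hord₀.1 hx₀ hR₀ hneg hsq
    exact false_of_seventeenShape hC W hux htype hsf f hW W₀ hW₀ hx₀ hneg hα

end Summit.BirchSwinnertonDyer.BirchSwinnertonDyer.Theorems.DepletionAtTwo.SigmaNode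

end
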